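import Literature.MathematicalPhysics.QuantumLattice.StrongCouplingBosonisation
import Literature.MathematicalPhysics.QuantumLattice.RossiWolffOneLinkIntegralSU
import HarnessLib

/-!
# Gauge field integration at `β = 0` for `SU(N)` with one staggered fermion: the effective
# fermionic weight with baryon hops (Rossi–Wolff 1984; Montvay–Münster §5.1.4; Fromm–de Forcrand (4)–(6))

Salmhofer–Seiler (CMP 139 (1991)) §2 performs the `β = 0` gauge integration for `G = U(N)` link by
link ((2.16)–(2.19); the tree: `StrongCoupling.gaugeAverage_eq` of `StrongCouplingBosonisation`) and
remark in §5, p. 424: "The case of `SU(N)` is technically more complicated; the set of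
`SU(N)`-invariants is larger than that of `U(N)`-invariants, which gives rise to other than
nearest-neighbour interactions in the effective fermionic theory (… baryon loops …)".  The
`SU(N)` one-link integral is printed in Montvay–Münster, *Quantum Fields on a Lattice* (1994),
§5.1.4 (5.42) and, for the staggered action with `N = 3`, in Fromm–de Forcrand, arXiv:0811.1931,
eq. (4)–(5): "`Z(m,μ) = ∫ ∏_x dχ_x dχ̄_x e^{2am…} ∏_{x,ν} F_{x,x+ν̂}`,
`F_{x,x+ν̂} = ∑_{k=0}^{3} α_k (M_xM_{x+ν̂})^k + [B̄_xB_{x+ν̂} η³_{x,ν̂} - B̄_{x+ν̂}B_x η_{x,ν̂}^{-3}]`,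
`α_k = (N_c-k)!/(N_c!k!)`" — the tree's `OneLink.oneLinkIntegralSU_staggered`
(`RossiWolffOneLinkIntegralSU`).

This file carries out the LATTICE-WIDE step for `SU(N)` exactly as `gaugeAverage_eq` does for
`U(N)`: with the same fermionic action `-S_F` (Salmhofer–Seiler (2.3)) but link variables in
`SU(N)` and the product Haar probability measure on `SU(N)^{links}`,

  `∫ 𝒟V e^{-S_F} = ∏_x e^{m ψ̄ψ(x)} · ∏_b F_b`,
  `F_b = B̃(¼ ψ̄ψ(x_b)ψ̄ψ(y_b)) + (-1)^{N(N-1)/2} ((-Γ_b/2)^N b̄(x_b)b(y_b) + (Γ_b/2)^N b̄(y_b)b(x_b))`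

(`gaugeAverageSU_eq`), `b̄(x) = ψ̄₁(x)⋯ψ̄_N(x)`, `b(x) = ψ₁(x)⋯ψ_N(x)` the ordered (anti)baryon
products at a site (`bbar`, `bar`; Montvay–Münster (5.44)).  Unlike the `U(N)` bond weight, `F_b`
DEPENDS ON THE SIGN `Γ_b` of the link (through `Γ_b^N`; for odd `N` the two hops carry opposite
signs, the relative sign of Fromm–de Forcrand (5)).

## Main statements

* `bbar`, `bar`, `bbar_mul_bar_mem_evenOdd_zero`, `commute_bbar_mul_bar` — the site baryon products,
  even and central; `linkEmbed_bbarX` … `linkEmbed_bY` — they are the images of the two-site ones;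
* `bondFactorSU x y Γ` and `cintegral_linkWeightAt_SU_staggered` — the `SU(N)` one-link factor on the
  lattice (`N ≥ 1`);
* `gaugeAverageSU`, **`gaugeAverageSU_eq`** — `∫ 𝒟V e^{-S_F}` as the product of site and bond factors;
* `fermiBracketSU`, `fermiZSU`, `fermiExpectSU`, `fermiBracketSU_const` — the unnormalised and
  normalised expectations (2.9)–(2.10) of the `β = 0` `SU(N)` theory and their reduction to a Berezin
  integral against the effective weight for gauge-invariant fermionic observables.

Honest framing: `β = 0`, one staggered flavour, finite lattice, any links with distinct endpoints
and any signs `Γ_b² = 1` (staggered phases with any boundary twists).  Nothing here is about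
`β > 0`, several flavours, positivity, the thermodynamic limit, chiral symmetry breaking, the
continuum, or the summit's QCD conjunct; it is the honest starting point ("first input", SS91 §5)
of an `SU(N)` version of the Salmhofer–Seiler analysis.

## References

* M. Salmhofer, E. Seiler, Commun. Math. Phys. 139 (1991) 395–432, §2 (2.3), (2.9)–(2.12),
  (2.16)–(2.19); §5 p. 424. [SalmhoferSeiler1991]
* I. Montvay, G. Münster, *Quantum Fields on a Lattice*, CUP 1994, §5.1.4 (5.38)–(5.44). [MontvayMunster1994]
* M. Fromm, Ph. de Forcrand, arXiv:0811.1931, eq. (4)–(6) p. 3. [FrommForcrand2008]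
* P. Rossi, U. Wolff, Nucl. Phys. B 248 (1984) 105–122. [RossiWolff1984]
-/

noncomputable section

namespace Literature.MathematicalPhysics.QuantumLattice

namespace StrongCoupling

open GrassmannAlgebra Matrix

section Baryon

variable {Λ : Type*} [LinearOrder Λ] {N : ℕ}

/-! ### The site baryon products -/

/-- **The ordered antibaryon product at a site**, `b̄(x) = ψ̄₁(x) ψ̄₂(x) ⋯ ψ̄_N(x)` (Montvay–Münster
(5.44): "`B̄_x ≡ ψ̄_{x1}ψ̄_{x2}ψ̄_{x3}`"). [cite: MontvayMunster1994, §5.1.4 (5.44)] -/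
def bbar (x : Λ) : FermiAlg Λ N := (List.ofFn fun a : Fin N => psiBar ℂ (cidx x a)).prod

/-- **The ordered baryon product at a site**, `b(x) = ψ₁(x) ψ₂(x) ⋯ ψ_N(x)` (Montvay–Münster (5.44):
"`B_x ≡ ψ_{x1}ψ_{x2}ψ_{x3}`"). [cite: MontvayMunster1994, §5.1.4 (5.44)] -/
def bar (x : Λ) : FermiAlg Λ N := (List.ofFn fun a : Fin N => psi ℂ (cidx x a)).prod

/-- A product of `N` generators has parity `N`. [cite: Berezin1966, Ch. I §3 (3.1)] -/
theorem prod_ofFn_gen_mem_evenOdd (w : Fin N → CIdx Λ N ⊕ₗ CIdx Λ N) :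
    (List.ofFn fun a => (gen ℂ (w a) : FermiAlg Λ N)).prod ∈ evenOdd ℂ (ι := CIdx Λ N ⊕ₗ CIdx Λ N) (N : ZMod 2) := by
  have h := SetLike.list_prod_map_mem_graded (A := evenOdd ℂ (ι := CIdx Λ N ⊕ₗ CIdx Λ N)) (List.finRange N)
    (fun _ => (1 : ZMod 2)) (fun a => (gen ℂ (w a) : FermiAlg Λ N)) fun a _ => gen_mem_evenOdd_one ℂ (w a)
  rwa [List.map_const', List.sum_replicate, List.length_finRange, nsmul_one, ← List.ofFn_eq_map] at h

/-- `b̄(x)` has parity `N`. [cite: Berezin1966, Ch. I §3 (3.1)] -/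
theorem bbar_mem_evenOdd (x : Λ) : (bbar x : FermiAlg Λ N) ∈ evenOdd ℂ (ι := CIdx Λ N ⊕ₗ CIdx Λ N) (N : ZMod 2) :=
  prod_ofFn_gen_mem_evenOdd fun a => barIdx (cidx x a)

/-- `b(x)` has parity `N`. [cite: Berezin1966, Ch. I §3 (3.1)] -/
theorem bar_mem_evenOdd (x : Λ) : (bar x : FermiAlg Λ N) ∈ evenOdd ℂ (ι := CIdx Λ N ⊕ₗ CIdx Λ N) (N : ZMod 2) :=
  prod_ofFn_gen_mem_evenOdd fun a => psiIdx (cidx x a)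

/-- A baryon hop `b̄(x) b(y)` is even. [cite: Berezin1966, Ch. I §3 (3.1)] -/
theorem bbar_mul_bar_mem_evenOdd_zero (x y : Λ) :
    (bbar x * bar y : FermiAlg Λ N) ∈ evenOdd ℂ (ι := CIdx Λ N ⊕ₗ CIdx Λ N) 0 := by
  have h := SetLike.mul_mem_graded (bbar_mem_evenOdd (N := N) x) (bar_mem_evenOdd (N := N) y)
  have h2 : ((N : ZMod 2) + N) = 0 := by
    rw [← two_mul, show (2 : ZMod 2) = 0 from rfl, zero_mul]
  rwa [h2] at h

/-- A baryon hop `b̄(x) b(y)` is central. [cite: Berezin1966, Ch. I §3 (3.1)] -/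
theorem commute_bbar_mul_bar (x y : Λ) (z : FermiAlg Λ N) : Commute (bbar x * bar y) z :=
  commute_of_mem_evenOdd_zero ℂ (bbar_mul_bar_mem_evenOdd_zero x y) z

/-- The two-site antibaryon at `x` goes to `b̄(x)`. [cite: MontvayMunster1994, §5.1.4 (5.44)] -/
theorem linkEmbed_bbarX {x y : Λ} (hxy : x ≠ y) : linkEmbed x y (OneLink.bbarX N) = (bbar x : FermiAlg Λ N) := by
  rw [OneLink.bbarX, map_list_prod, List.map_ofFn, bbar]
  exact congrArg (fun f : Fin N → FermiAlg Λ N => (List.ofFn f).prod)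
    (funext fun a => by simp only [Function.comp_apply, linkEmbed_psiBar hxy, linkIdx_xc])

/-- The two-site baryon at `y` goes to `b(y)`. [cite: MontvayMunster1994, §5.1.4 (5.44)] -/
theorem linkEmbed_bY {x y : Λ} (hxy : x ≠ y) : linkEmbed x y (OneLink.bY N) = (bar y : FermiAlg Λ N) := by
  rw [OneLink.bY, map_list_prod, List.map_ofFn, bar]
  exact congrArg (fun f : Fin N → FermiAlg Λ N => (List.ofFn f).prod)
    (funext fun a => by simp only [Function.comp_apply, linkEmbed_psi hxy, linkIdx_yc])

/-- The two-site antibaryon at `y` goes to `b̄(y)`. [cite: MontvayMunster1994, §5.1.4 (5.44)] -/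
theorem linkEmbed_bbarY {x y : Λ} (hxy : x ≠ y) : linkEmbed x y (OneLink.bbarY N) = (bbar y : FermiAlg Λ N) := by
  rw [OneLink.bbarY, map_list_prod, List.map_ofFn, bbar]
  exact congrArg (fun f : Fin N → FermiAlg Λ N => (List.ofFn f).prod)
    (funext fun a => by simp only [Function.comp_apply, linkEmbed_psiBar hxy, linkIdx_yc])

/-- The two-site baryon at `x` goes to `b(x)`. [cite: MontvayMunster1994, §5.1.4 (5.44)] -/
theorem linkEmbed_bX {x y : Λ} (hxy : x ≠ y) : linkEmbed x y (OneLink.bX N) = (bar x : FermiAlg Λ N) := by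
  rw [OneLink.bX, map_list_prod, List.map_ofFn, bar]
  exact congrArg (fun f : Fin N → FermiAlg Λ N => (List.ofFn f).prod)
    (funext fun a => by simp only [Function.comp_apply, linkEmbed_psi hxy, linkIdx_xc])

/-! ### The `SU(N)` bond factor -/

/-- **The `SU(N)` one-link factor on the lattice** for the staggered couplings `s = -Γ/2`, `s' = Γ/2`:
`F = B̃(¼ ψ̄ψ(x)ψ̄ψ(y)) + (-1)^{N(N-1)/2} ((-Γ/2)^N b̄(x)b(y) + (Γ/2)^N b̄(y)b(x))` — the `U(N)` bond
weight `bondFactor` (Salmhofer–Seiler (2.16)–(2.17)) plus the two baryon hops of Montvay–Münster (5.42)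
/ Fromm–de Forcrand (5). [cite: MontvayMunster1994, §5.1.4 (5.42)] [cite: FrommForcrand2008, (5)] -/
def bondFactorSU (x y : Λ) (Γ : ℂ) : FermiAlg Λ N :=
  bondFactor x y + ((-1 : ℂ) ^ (N * (N - 1) / 2)) • ((-(Γ / 2)) ^ N • (bbar x * bar y) + (Γ / 2) ^ N • (bbar y * bar x))

/-- The `SU(N)` bond factor is central (it is even). [cite: MontvayMunster1994, §5.1.4 (5.42)] -/
theorem commute_bondFactorSU [Fintype Λ] (x y : Λ) (Γ : ℂ) (z : FermiAlg Λ N) : Commute (bondFactorSU x y Γ) z :=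
  (commute_bondFactor x y z).add_left
    ((((commute_bbar_mul_bar x y z).smul_left _).add_left ((commute_bbar_mul_bar y x z).smul_left _)).smul_left _)

/-- The `SU(N)` bond factor is the image of the two-site one-link integral for the staggered couplings
(`N ≥ 1`, `Γ² = 1`). [cite: MontvayMunster1994, §5.1.4 (5.42)] [cite: FrommForcrand2008, (5)] -/
theorem linkEmbed_oneLinkIntegralSU_staggered [Fintype Λ] {x y : Λ} (hxy : x ≠ y) (hN : 0 < N) (Γ : ℂ) (hΓ : Γ ^ 2 = 1) :
    linkEmbed x y (OneLink.oneLinkIntegralSU (-(Γ / 2)) (Γ / 2) : OneLink.Alg N) = bondFactorSU x y Γ := by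
  rw [OneLink.oneLinkIntegralSU_staggered hN Γ hΓ, map_add, ← OneLink.oneLinkIntegral_staggered Γ hΓ,
    ← cintegral_linkWeightAt hxy, cintegral_linkWeightAt_staggered hxy Γ hΓ, bondFactorSU, map_smul, map_add,
    map_smul, map_smul, map_mul, map_mul, linkEmbed_bbarX hxy, linkEmbed_bY hxy, linkEmbed_bbarY hxy, linkEmbed_bX hxy]

/-- **The `SU(N)` bond factor in exponential form**: the `k = 0` and `k = N` terms together with the two
hops are the exponential of the hops (the `N`-fold dimer is the baryonic 2-cycle,
`OneLink.topDimer_eq_baryonHop_mul`), leaving the PARTIAL dimers `1 ≤ k ≤ N-1`: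
`F_{xy}(Γ) = exp(κ b̄(x)b(y) + κ' b̄(y)b(x)) + ∑_{k=1}^{N-1} (N-k)!/(N!k!) (¼ ψ̄ψ(x)ψ̄ψ(y))^k`,
`κ = (-1)^{N(N-1)/2} (-Γ/2)^N`, `κ' = (-1)^{N(N-1)/2} (Γ/2)^N` (`x ≠ y`, `N ≥ 1`, `Γ² = 1`). [cite: MontvayMunster1994, §5.1.4 (5.42)] [cite: FrommForcrand2008, (5)–(6)] -/
theorem bondFactorSU_eq_exp_add [Fintype Λ] {x y : Λ} (hxy : x ≠ y) (hN : 0 < N) (Γ : ℂ) (hΓ : Γ ^ 2 = 1) :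
    (bondFactorSU x y Γ : FermiAlg Λ N) =
      grassmannExp ((((-1 : ℂ) ^ (N * (N - 1) / 2) * (-(Γ / 2)) ^ N)) • (bbar x * bar y) +
        (((-1 : ℂ) ^ (N * (N - 1) / 2) * (Γ / 2) ^ N)) • (bbar y * bar x)) +
      ∑ k ∈ Finset.Ico 1 N,
        (((N - k).factorial : ℂ) / ((N.factorial : ℂ) * (k.factorial : ℂ))) •
          ((1 / 4 : ℂ) • (meson x * meson y)) ^ k := by
  rw [← linkEmbed_oneLinkIntegralSU_staggered hxy hN Γ hΓ, OneLink.oneLinkIntegralSU_staggered_eq_exp_add hN Γ hΓ,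
    map_add, linkEmbed_grassmannExp, map_add, map_smul, map_smul, map_mul, map_mul, linkEmbed_bbarX hxy,
    linkEmbed_bY hxy, linkEmbed_bbarY hxy, linkEmbed_bX hxy, map_sum]
  congr 1
  refine Finset.sum_congr rfl fun k _ => ?_
  rw [map_smul, map_pow, map_smul, map_mul, linkEmbed_mesonX hxy, linkEmbed_mesonY hxy]

/-- The two hops on the lattice square to zero: `(b̄(x)b(y))² = 0` (`N ≥ 1`, `x ≠ y`). [cite: Berezin1966, Ch. I §3 (3.1)] -/
theorem bbar_mul_bar_mul_self [Fintype Λ] {x y : Λ} (hxy : x ≠ y) (hN : 0 < N) :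
    (bbar x * bar y : FermiAlg Λ N) * (bbar x * bar y) = 0 := by
  rw [← linkEmbed_bbarX hxy, ← linkEmbed_bY hxy, ← map_mul, ← map_mul, OneLink.baryonHop_mul_self hN, map_zero]

/-- **The product of the two hops of one link is the `N`-fold dimer**, on the lattice:
`κκ' · b̄(x)b(y) b̄(y)b(x) = (N!N!)⁻¹ (¼ψ̄ψ(x)ψ̄ψ(y))^N` for the staggered couplings (`Γ² = 1`). [cite: MontvayMunster1994, §5.1.4 (5.42)–(5.44)] [cite: FrommForcrand2008, (5)–(6)] -/
theorem hops_mul_eq_topDimer [Fintype Λ] {x y : Λ} (hxy : x ≠ y) (Γ : ℂ) (hΓ : Γ ^ 2 = 1) :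
    ((((-1 : ℂ) ^ (N * (N - 1) / 2) * (-(Γ / 2)) ^ N)) * (((-1 : ℂ) ^ (N * (N - 1) / 2) * (Γ / 2) ^ N))) •
        ((bbar x * bar y) * (bbar y * bar x) : FermiAlg Λ N) =
      (((N - N).factorial : ℂ) / ((N.factorial : ℂ) * (N.factorial : ℂ))) • ((1 / 4 : ℂ) • (meson x * meson y)) ^ N := by
  rw [← linkEmbed_bbarX hxy, ← linkEmbed_bY hxy, ← linkEmbed_bbarY hxy, ← linkEmbed_bX hxy, ← map_mul, ← map_mul,
    ← map_mul, ← map_smul, ← OneLink.topDimer_eq_baryonHop_mul, map_smul, map_pow, map_mul, linkEmbed_mesonX hxy,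
    linkEmbed_mesonY hxy, _root_.smul_pow, smul_smul]
  congr 1
  have h : -(-(Γ / 2) * (Γ / 2)) = (1 / 4 : ℂ) := by linear_combination hΓ / 4
  rw [h]
  ring

end Baryon

/-! ### The `SU(N)` gauge average at `β = 0` -/

section Gauge

open _root_.MeasureTheory
open Literature.MathematicalPhysics.QuantumFieldTheory (haarProbability)

variable {Λ : Type*} [LinearOrder Λ] [Fintype Λ] {N : ℕ}
variable {B : Type*} [Fintype B] [DecidableEq B]

/-- The inclusion `SU(N) → U(N)` is continuous. [folklore] -/
private theorem continuous_inclSU : Continuous (OneLink.inclSU N) :=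
  continuous_induced_rng.2 continuous_subtype_val

/-- The inclusion `SU(N) → U(N)` on matrices. [folklore] -/
private theorem coe_inclSU (V : OneLink.SUN N) :
    ((OneLink.inclSU N V : OneLink.UN N) : Matrix (Fin N) (Fin N) ℂ) = (V : Matrix (Fin N) (Fin N) ℂ) := rfl

/-- **Minus the staggered fermion action with `SU(N)` link variables**, `-S_F` of Salmhofer–Seiler (2.3)
at `β = 0` for `G = SU(N)` (the `U(N)` expression `negAction` read on `SU(N) ⊂ U(N)`). [cite: SalmhoferSeiler1991, §2 (2.3)] -/
def negActionSU (l : B → Λ × Λ) (Γ : B → ℂ) (m : ℂ) (V : B → OneLink.SUN N) : FermiAlg Λ N :=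
  negAction l Γ m fun b => OneLink.inclSU N (V b)

/-- **The fermionic Boltzmann weight `e^{-S_F}`** at `β = 0` as a function of the `SU(N)` gauge field. [cite: SalmhoferSeiler1991, §2 (2.2)–(2.3), (2.9)] -/
def fermiBoltzmannSU (l : B → Λ × Λ) (Γ : B → ℂ) (m : ℂ) (V : B → OneLink.SUN N) : FermiAlg Λ N :=
  fermiBoltzmann l Γ m fun b => OneLink.inclSU N (V b)

omit [DecidableEq B] in
/-- `e^{-S_F} = exp(-S_F)` for the `SU(N)` field. [cite: SalmhoferSeiler1991, §2 (2.9)] -/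
theorem fermiBoltzmannSU_eq_grassmannExp (l : B → Λ × Λ) (Γ : B → ℂ) (m : ℂ) (V : B → OneLink.SUN N) :
    fermiBoltzmannSU l Γ m V = grassmannExp (negActionSU l Γ m V) := rfl

variable (N B) in
/-- The gauge measure `𝒟_Λ V = ∏_b dV_b`, `dV` the Haar probability measure on `SU(N)` ((2.12) with
`G = SU(N)`; Montvay–Münster (5.38) `∫_G dU`). [cite: SalmhoferSeiler1991, §2 (2.12)] [cite: MontvayMunster1994, §5.1.4 (5.38)] -/
def gaugeMeasureSU : Measure (B → OneLink.SUN N) := Measure.pi fun _ => haarProbability (OneLink.SUN N)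

/-- **The `SU(N)` gauge average `∫ 𝒟V e^{-S_F}`** of the fermionic Boltzmann weight at `β = 0` (the
effective fermionic weight; coefficientwise integral). [cite: SalmhoferSeiler1991, §2 (2.9), (2.19)] [cite: FrommForcrand2008, (4)] -/
def gaugeAverageSU (l : B → Λ × Λ) (Γ : B → ℂ) (m : ℂ) : FermiAlg Λ N :=
  cintegral (gaugeMeasureSU N B) (fermiBoltzmannSU l Γ m)

/-- The coordinates of the lattice link weight are continuous functions of `V ∈ SU(N)` (`x ≠ y`). [cite: SalmhoferSeiler1991, §2 (2.12)] -/
theorem coeffContinuous_linkWeightAt_SU {x y : Λ} (hxy : x ≠ y) (s s' : ℂ) :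
    CoeffContinuous fun V : OneLink.SUN N => linkWeightAt x y s s' (V : Matrix (Fin N) (Fin N) ℂ) := by
  have h := (coeffContinuous_linkWeightAt (Λ := Λ) (N := N) hxy s s').comp (continuous_inclSU (N := N))
  have hfun : (fun V : OneLink.SUN N => linkWeightAt x y s s' (V : Matrix (Fin N) (Fin N) ℂ)) =
      fun V : OneLink.SUN N => linkWeightAt x y s s' ((OneLink.inclSU N V : OneLink.UN N) : Matrix (Fin N) (Fin N) ℂ) := by
    funext V; rw [coe_inclSU]
  rw [hfun]; exact h

/-- **The `SU(N)` one-link integral on the lattice** is the image of the two-site one-link integral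
`OneLink.oneLinkIntegralSU` under the link embedding. [cite: MontvayMunster1994, §5.1.4 (5.38)–(5.42)] -/
theorem cintegral_linkWeightAt_SU {x y : Λ} (hxy : x ≠ y) (s s' : ℂ) :
    cintegral (haarProbability (OneLink.SUN N))
        (fun V => linkWeightAt x y s s' (V : Matrix (Fin N) (Fin N) ℂ)) =
      linkEmbed x y (OneLink.oneLinkIntegralSU s s') := by
  have hI : CoeffIntegrable (haarProbability (OneLink.SUN N))
      fun V : OneLink.SUN N => OneLink.linkWeight s s' (V : Matrix (Fin N) (Fin N) ℂ) := by
    have h := ((OneLink.coeffContinuous_linkWeight (N := N) s s').comp (continuous_inclSU (N := N))).coeffIntegrable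
      (μ := haarProbability (OneLink.SUN N))
    have hfun : (fun V : OneLink.SUN N => OneLink.linkWeight s s' (V : Matrix (Fin N) (Fin N) ℂ)) =
        fun V : OneLink.SUN N => OneLink.linkWeight s s' ((OneLink.inclSU N V : OneLink.UN N) : Matrix (Fin N) (Fin N) ℂ) := by
      funext V; rw [coe_inclSU]
    rw [hfun]; exact h
  rw [OneLink.oneLinkIntegralSU, show linkEmbed x y _ = _ from map_cintegral (linkEmbed x y).toLinearMap hI]
  exact cintegral_congr fun V => (linkEmbed_linkWeight hxy s s' _).symm

/-- **The `SU(N)` one-link integral of the staggered action on the lattice** (`N ≥ 1`, `Γ² = 1`):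
`∫_{SU(N)} dV e^{-½Γ ψ̄(x)Vψ(y)} e^{½Γ ψ̄(y)V†ψ(x)} = F_{xy}(Γ)` (`bondFactorSU`). [cite: MontvayMunster1994, §5.1.4 (5.42)] [cite: FrommForcrand2008, (5)] -/
theorem cintegral_linkWeightAt_SU_staggered {x y : Λ} (hxy : x ≠ y) (hN : 0 < N) (Γ : ℂ) (hΓ : Γ ^ 2 = 1) :
    cintegral (haarProbability (OneLink.SUN N))
        (fun V => linkWeightAt x y (-(Γ / 2)) (Γ / 2) (V : Matrix (Fin N) (Fin N) ℂ)) = bondFactorSU x y Γ := by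
  rw [cintegral_linkWeightAt_SU hxy, linkEmbed_oneLinkIntegralSU_staggered hxy hN Γ hΓ]

/-- `e^{-S_F}` (`SU(N)` field) with the link factors as an ordered product along an enumeration of the links. [cite: SalmhoferSeiler1991, §2 (2.3)] -/
theorem fermiBoltzmannSU_eq_ofFn (l : B → Λ × Λ) (Γ : B → ℂ) (m : ℂ) {n : ℕ} (e : Fin n ≃ B) (V : B → OneLink.SUN N) :
    fermiBoltzmannSU l Γ m V =
      Finset.univ.noncommProd (fun x => grassmannExp (m • (meson x : FermiAlg Λ N)))
          (fun x _ _ _ _ => commute_grassmannExp_smul_meson m x _) *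
        (List.ofFn fun i => linkWeightAt (l (e i)).1 (l (e i)).2 (-(Γ (e i) / 2)) (Γ (e i) / 2)
          (V (e i) : Matrix (Fin N) (Fin N) ℂ)).prod := by
  rw [fermiBoltzmannSU, fermiBoltzmann_eq_ofFn l Γ m e]
  simp only [coe_inclSU]

/-- The coordinates of `e^{-S_F}` are continuous functions of the `SU(N)` gauge field. [cite: SalmhoferSeiler1991, §2 (2.12)] -/
theorem coeffContinuous_fermiBoltzmannSU (l : B → Λ × Λ) (hl : ∀ b, (l b).1 ≠ (l b).2) (Γ : B → ℂ) (m : ℂ) :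
    CoeffContinuous (fermiBoltzmannSU (N := N) l Γ m) := by
  have h := (coeffContinuous_fermiBoltzmann (Λ := Λ) (N := N) l hl Γ m).comp
    (continuous_pi fun b => (continuous_inclSU (N := N)).comp (continuous_apply b))
  exact h

/-- The coordinates of `e^{-S_F}` are integrable for `𝒟V` (a finite measure on the compact group
`SU(N)^{links}`). [cite: SalmhoferSeiler1991, §2 (2.12)] -/
theorem coeffIntegrable_fermiBoltzmannSU (l : B → Λ × Λ) (hl : ∀ b, (l b).1 ≠ (l b).2) (Γ : B → ℂ) (m : ℂ) :
    CoeffIntegrable (gaugeMeasureSU N B) (fermiBoltzmannSU (Λ := Λ) l Γ m) := by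
  haveI : SecondCountableTopology (OneLink.SUN N) := by
    haveI : SecondCountableTopology (Matrix (Fin N) (Fin N) ℂ) :=
      inferInstanceAs (SecondCountableTopology (Fin N → Fin N → ℂ))
    exact TopologicalSpace.Subtype.secondCountableTopology _
  haveI : IsFiniteMeasureOnCompacts (gaugeMeasureSU N B) := by unfold gaugeMeasureSU; infer_instance
  exact (coeffContinuous_fermiBoltzmannSU l hl Γ m).coeffIntegrable

/-- Coefficientwise integrability of `F · e^{-S_F}` for a continuous family `F(V)`. [cite: SalmhoferSeiler1991, §2 (2.12)] -/
theorem coeffIntegrable_mul_fermiBoltzmannSU (l : B → Λ × Λ) (hl : ∀ b, (l b).1 ≠ (l b).2) (Γ : B → ℂ) (m : ℂ)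
    {F : (B → OneLink.SUN N) → FermiAlg Λ N} (hF : CoeffContinuous F) :
    CoeffIntegrable (gaugeMeasureSU N B) fun V => F V * fermiBoltzmannSU l Γ m V := by
  haveI : SecondCountableTopology (OneLink.SUN N) := by
    haveI : SecondCountableTopology (Matrix (Fin N) (Fin N) ℂ) :=
      inferInstanceAs (SecondCountableTopology (Fin N → Fin N → ℂ))
    exact TopologicalSpace.Subtype.secondCountableTopology _
  haveI : IsFiniteMeasureOnCompacts (gaugeMeasureSU N B) := by unfold gaugeMeasureSU; infer_instance
  exact (hF.mul (coeffContinuous_fermiBoltzmannSU l hl Γ m)).coeffIntegrable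

/-- **`SU(N)` gauge field integration at strong coupling** (Rossi–Wolff; Montvay–Münster (5.38)–(5.42);
Fromm–de Forcrand (4)–(5): "Integrating out the gauge links we obtain … `Z = ∫ ∏_x dχ̄_x dχ_x e^{…}
∏_{x,ν} F_{x,x+ν̂}`").  At `β = 0` the gauge integration is done separately on each link: for `N ≥ 1`,
links with distinct endpoints and signs `Γ_b² = 1`,
`∫ 𝒟V e^{-S_F} = ∏_x e^{m ψ̄ψ(x)} · ∏_b F_b`, `F_b = bondFactorSU x_b y_b Γ_b`. [cite: FrommForcrand2008, (4)–(5)] [cite: MontvayMunster1994, §5.1.4 (5.38)–(5.42)] -/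
theorem gaugeAverageSU_eq (hN : 0 < N) (l : B → Λ × Λ) (hl : ∀ b, (l b).1 ≠ (l b).2) (Γ : B → ℂ)
    (hΓ : ∀ b, Γ b ^ 2 = 1) (m : ℂ) :
    (gaugeAverageSU l Γ m : FermiAlg Λ N) =
      Finset.univ.noncommProd (fun x => grassmannExp (m • (meson x : FermiAlg Λ N)))
          (fun x _ _ _ _ => commute_grassmannExp_smul_meson m x _) *
        Finset.univ.noncommProd (fun b => bondFactorSU (l b).1 (l b).2 (Γ b))
          (fun _ _ _ _ _ => commute_bondFactorSU _ _ _ _) := by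
  set e : Fin (Fintype.card B) ≃ B := (Fintype.equivFin B).symm with he
  set W : B → OneLink.SUN N → FermiAlg Λ N := fun b V =>
    linkWeightAt (l b).1 (l b).2 (-(Γ b / 2)) (Γ b / 2) (V : Matrix (Fin N) (Fin N) ℂ) with hW
  have hWc : ∀ b, CoeffContinuous (W b) := fun b => coeffContinuous_linkWeightAt_SU (hl b) _ _
  haveI : SecondCountableTopology (OneLink.SUN N) := by
    haveI : SecondCountableTopology (Matrix (Fin N) (Fin N) ℂ) :=
      inferInstanceAs (SecondCountableTopology (Fin N → Fin N → ℂ))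
    exact TopologicalSpace.Subtype.secondCountableTopology _
  have hG : CoeffIntegrable (gaugeMeasureSU N B) fun V : B → OneLink.SUN N =>
      (List.ofFn fun i => W (e i) (V (e i))).prod := by
    haveI : IsFiniteMeasureOnCompacts (gaugeMeasureSU N B) := by unfold gaugeMeasureSU; infer_instance
    exact (CoeffContinuous.ofFn_prod fun i => (hWc (e i)).comp (continuous_apply (e i))).coeffIntegrable
  have hpi := cintegral_pi_prod_ofFn e.toEmbedding (haarProbability (OneLink.SUN N)) W fun b => (hWc b).coeffIntegrable
  simp only [Equiv.coe_toEmbedding] at hpi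
  unfold gaugeAverageSU
  rw [cintegral_congr fun V => fermiBoltzmannSU_eq_ofFn l Γ m e V, cintegral_const_mul _ hG]
  unfold gaugeMeasureSU
  rw [hpi, noncommProd_univ_eq_prod_ofFn e (fun b => bondFactorSU (l b).1 (l b).2 (Γ b))]
  congr 2
  exact congrArg List.ofFn (funext fun i => cintegral_linkWeightAt_SU_staggered (hl (e i)) hN (Γ (e i)) (hΓ (e i)))

/-! ### Expectations of the strongly coupled `SU(N)` theory (Salmhofer–Seiler (2.9)–(2.10), `G = SU(N)`) -/

/-- **The unnormalised expectation `∫ 𝒟_Λψψ̄ 𝒟_ΛV e^{-S} f(V, ψ, ψ̄)` at `β = 0`** for `G = SU(N)`: the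
Berezin integral of the gauge average of `f(V) e^{-S_F(V)}`. [cite: SalmhoferSeiler1991, §2 (2.9)–(2.10)] -/
def fermiBracketSU (l : B → Λ × Λ) (Γ : B → ℂ) (m : ℂ) (F : (B → OneLink.SUN N) → FermiAlg Λ N) : ℂ :=
  berezin ℂ _ (cintegral (gaugeMeasureSU N B) fun V => F V * fermiBoltzmannSU l Γ m V)

/-- **The partition function `Z_Λ = ∫ 𝒟_Λψψ̄ 𝒟_ΛV e^{-S}`** at `β = 0` for `G = SU(N)` ((2.9); Fromm–de
Forcrand (4)). [cite: SalmhoferSeiler1991, §2 (2.9)] [cite: FrommForcrand2008, (4)] -/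
def fermiZSU (l : B → Λ × Λ) (Γ : B → ℂ) (m : ℂ) : ℂ := fermiBracketSU (N := N) l Γ m fun _ => 1

/-- **The expectation `⟨f⟩_{S,Λ} = Z_Λ⁻¹ ∫ 𝒟_Λψψ̄ 𝒟_ΛV e^{-S} f`** at `β = 0` for `G = SU(N)` ((2.10); junk
`0` if `Z_Λ = 0`). [cite: SalmhoferSeiler1991, §2 (2.10)] -/
def fermiExpectSU (l : B → Λ × Λ) (Γ : B → ℂ) (m : ℂ) (F : (B → OneLink.SUN N) → FermiAlg Λ N) : ℂ :=
  fermiBracketSU l Γ m F / fermiZSU (N := N) l Γ m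

/-- For an observable `F(ψ̄, ψ)` not depending on the gauge field, the gauge integral acts on `e^{-S_F}`
alone: `∫∫ F e^{-S} = ∫dψ̄dψ F · (∫𝒟V e^{-S_F})`. [cite: SalmhoferSeiler1991, §2 (2.10), (2.19)] -/
theorem fermiBracketSU_const (l : B → Λ × Λ) (hl : ∀ b, (l b).1 ≠ (l b).2) (Γ : B → ℂ) (m : ℂ) (F : FermiAlg Λ N) :
    fermiBracketSU l Γ m (fun _ => F) = berezin ℂ _ (F * gaugeAverageSU l Γ m) := by
  rw [fermiBracketSU, cintegral_const_mul F (coeffIntegrable_fermiBoltzmannSU l hl Γ m), gaugeAverageSU]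

/-- Linearity of the unnormalised expectation in a constant observable. [cite: SalmhoferSeiler1991, §2 (2.10)] -/
theorem fermiBracketSU_const_smul (l : B → Λ × Λ) (hl : ∀ b, (l b).1 ≠ (l b).2) (Γ : B → ℂ) (m : ℂ) (c : ℂ)
    (F : FermiAlg Λ N) : fermiBracketSU l Γ m (fun _ => c • F) = c * fermiBracketSU l Γ m (fun _ => F) := by
  rw [fermiBracketSU_const l hl, fermiBracketSU_const l hl, smul_mul_assoc, map_smul, smul_eq_mul]

/-- **The partition function and the constant observables of the `β = 0` `SU(N)` theory as Berezin
integrals against the effective weight** `∏_x e^{mψ̄ψ(x)} ∏_b F_b` (Fromm–de Forcrand (4)). [cite: FrommForcrand2008, (4)–(5)] -/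
theorem fermiBracketSU_const_eq (hN : 0 < N) (l : B → Λ × Λ) (hl : ∀ b, (l b).1 ≠ (l b).2) (Γ : B → ℂ)
    (hΓ : ∀ b, Γ b ^ 2 = 1) (m : ℂ) (F : FermiAlg Λ N) :
    fermiBracketSU l Γ m (fun _ => F) =
      berezin ℂ _ (F * (Finset.univ.noncommProd (fun x => grassmannExp (m • (meson x : FermiAlg Λ N)))
          (fun x _ _ _ _ => commute_grassmannExp_smul_meson m x _) *
        Finset.univ.noncommProd (fun b => bondFactorSU (l b).1 (l b).2 (Γ b))
          (fun _ _ _ _ _ => commute_bondFactorSU _ _ _ _))) := by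
  rw [fermiBracketSU_const l hl, gaugeAverageSU_eq hN l hl Γ hΓ]

end Gauge

end StrongCoupling

end Literature.MathematicalPhysics.QuantumLattice
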